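import Literature.AlgebraicGeometry.AbelianSchemes.AbelianSchemeDualRingAction
import HarnessLib

/-!
# The dual of an `𝒪`-equivariant homomorphism is `𝒪`-equivariant for the dual ring actions

Topic `Literature/AlgebraicGeometry/AbelianSchemes`, namespace `Literature.AlgebraicGeometry.AbelianSchemes.AbelianSchemeOver.RingAction` (THEOREMS ONLY; no definition,
no named fact, no `sorry`, no `instance`, no notation; base `S` reduced and locally Noetherian, unit hypotheses `hDA`, `hDB`).  Cell `hodgecm-mathlib`, F0/P6 «MOD»,
sequel to ★ (D1) `AbelianSchemeDualRingAction` (`RingAction.dual`): equivariance of `ψ^∨` (in particular of `ψ_P^∨`, the dual of the ideal translation) for the dual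
actions; `--supports stmt-HodgeConjecture-24832`, count-neutral.  HC_CM is proved only modulo the 2 remaining named inputs (hLiu418, h413) until rung 0 closes;
this file discharges none of them.

## Mathematics

If `ι_A(a) ≫ ψ = ψ ≫ ι_B(a)` then dualising (★ `dualIsogenyOver_comp`, contravariant) gives `ψ^∨ ≫ ι_A(a)^∨ = ι_B(a)^∨ ≫ ψ^∨`, i.e. `ψ^∨ : B̂ → Â` is
equivariant for `ι_B^∨`, `ι_A^∨` ([MumfordAV1970] §15 Thm. 1 functoriality; [RapoportSmithlingZhang2020Diagonal] §3.2).

## Contents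

* `dualIsogenyOver_comm_of_comm` (`α ≫ ψ = ψ ≫ β ⟹ ψ^∨ ≫ α^∨ = β^∨ ≫ ψ^∨`), **`dual_i_comp_dualIsogenyOver`** (`ι_B^∨(a) ≫ ψ^∨ = ψ^∨ ≫ ι_A^∨(a)`).

## References
* [MumfordAV1970] D. Mumford, *Abelian Varieties* (1970), §15 Thm. 1 (p. 143).
* [RapoportSmithlingZhang2020Diagonal] M. Rapoport, B. Smithling, W. Zhang (2020), §3.2.
* Tree: ★ `AbelianSchemeDualRingAction`, ★ `AbelianSchemeDualIsogenyComp`, ★ `dualIsogenyOver_congr`.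
-/

noncomputable section

universe u

open CategoryTheory CategoryTheory.Limits AlgebraicGeometry MonoidalCategory CartesianMonoidalCategory
open scoped MonObj

namespace Literature.AlgebraicGeometry.AbelianSchemes

namespace AbelianSchemeOver

variable {S : Scheme.{u}} {A B : AbelianSchemeOver S} (ψ : A.X ⟶ B.X) [IsMonHom ψ] (DA : A.DualPair) (DB : B.DualPair)

/-- **Dualising a commutative square**: `α ≫ ψ = ψ ≫ β` (homomorphisms) gives `ψ^∨ ≫ α^∨ = β^∨ ≫ ψ^∨`. [cite: MumfordAV1970, §15 Thm. 1 (p. 143)] -/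
theorem DualPair.dualIsogenyOver_comm_of_comm (α : A.X ⟶ A.X) (β : B.X ⟶ B.X) [IsMonHom α] [IsMonHom β] (h : α ≫ ψ = ψ ≫ β) :
    DualPair.dualIsogenyOver ψ DA DB ≫ DualPair.dualIsogenyOver α DA DA =
      DualPair.dualIsogenyOver β DB DB ≫ DualPair.dualIsogenyOver ψ DA DB := by
  rw [← DualPair.dualIsogenyOver_comp α ψ DA DA DB, ← DualPair.dualIsogenyOver_comp ψ β DA DB DB]
  exact DualPair.dualIsogenyOver_congr DA DB h

variable [IsReduced S] [IsLocallyNoetherian S] {O : Type*} [CommRing O] (actA : A.RingAction O) (actB : B.RingAction O)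
  (hDA : Nonempty ((Scheme.Modules.pullback (DualPair.unitHatSlice DA)).obj DA.P ≅ SheafOfModules.unit _))
  (hDB : Nonempty ((Scheme.Modules.pullback (DualPair.unitHatSlice DB)).obj DB.P ≅ SheafOfModules.unit _))

/-- **`ψ^∨` is `𝒪`-EQUIVARIANT for the dual actions**: `ι_A(a) ≫ ψ = ψ ≫ ι_B(a)` for all `a` ⟹ `ι_B^∨(a) ≫ ψ^∨ = ψ^∨ ≫ ι_A^∨(a)`.
[cite: MumfordAV1970, §15 Thm. 1 (p. 143)] [cite: RapoportSmithlingZhang2020Diagonal, §3.2] -/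
theorem RingAction.dual_i_comp_dualIsogenyOver (hψ : ∀ a, actA.i a ≫ ψ = ψ ≫ actB.i a) (a : O) :
    (actB.dual DB hDB).i a ≫ DualPair.dualIsogenyOver ψ DA DB = DualPair.dualIsogenyOver ψ DA DB ≫ (actA.dual DA hDA).i a := by
  haveI := actA.isMonHom a
  haveI := actB.isMonHom a
  rw [RingAction.dual_i, RingAction.dual_i]
  exact (DualPair.dualIsogenyOver_comm_of_comm ψ DA DB (actA.i a) (actB.i a) (hψ a)).symm

end AbelianSchemeOver

end Literature.AlgebraicGeometry.AbelianSchemes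

end
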